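import Mathlib
import Summits.KontsevichZagierPeriods.Zeta5Search.DecompositionWholeCone
import Summits.KontsevichZagierPeriods.Zeta5Search.Brown8.LeadingCoefficientCone
import Summits.KontsevichZagierPeriods.Zeta5Search.WedgeDictionaryClosing
import Summits.KontsevichZagierPeriods.Zeta5Search.InvarianceOfConverges
import HarnessLib

/-!
# Consequences of the whole-cone decomposition: the last `decomposition`-conditional corollaries and nodes,
# hypothesis-free (cell `pub-zeta5`, seat ct-1 g25)

HONEST FRAMING: systematic search; no irrationality claim unless certified.  MODUS PONENS ONLY over landed theorems:
ct-1 g24's `DecompositionWholeCone.decomposition_holds` (Brown–Zudilin's (4) with (17) on the WHOLE convergence cone,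
[BrownZudilin2022, Sect. 1, eq. (4); Sect. 5, eq. (17)]), ct-1 g21's `WedgeDictionaryClosing.wedgeDictionary_holds` and
ct-1 g13's `InvarianceOfConverges.invariance_of_converges'_holds`, fed into implications that were ALREADY in the tree with
those statements as HYPOTHESES.  No integral is evaluated here, no new node is minted, no `def`; nothing about `ζ(5)`, no `γ`,
no denominator statement; records in print unmoved.

1. **Obligation nodes discharged** (internally minted `@[conjecture]` statements, each typed in the tree as a consequence of
   `decomposition`): fam-brown8's `Families.Cellular.BZSubconeZeta3Free` and `Families.Cellular.BZXStarZeta3Free`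
   (`CellularEightMiddleWeights`, via `bzSubconeZeta3Free_of_decomposition` / `bzXStarZeta3Free_of_decomposition`), and the
   integral half `WedgeDictionary.wedgeDictionaryIntegralPart` of gen-1's wedge dictionary (`WedgeDictionaryQPart`, via
   `wedgeDictionary_iff_integralPart`).
2. **Conditional corollaries made unconditional** (fam-brown8 g11 / `Brown8/LeadingCoefficient{,Cone}`, `Brown8/XStarOrbitCover`):
   off the LIVE cone (`¬ LiveBZ a`, equivalently `Q(a) = 0` by `liveBZ_iff_QOf_ne_zero`) the cellular integral and its whole ray
   lie in `ℚζ(2) + ℚ`; on the whole cone `I(a) = qθ + rζ(2) + s` with `q ≠ 0 ↔ LiveBZ a` (`θ = 2ζ(5) + 4ζ(3)ζ(2)`); the specimen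
   `c = (2,0,4,0,2,1,1,4)`; and the census/mw capstone `liveBZ_zeta3Free` (its two hypotheses (27) and the `X*`-law are theorems).

What this is NOT: anything analytic or arithmetic beyond (4) itself — every statement below is WEAKER than `decomposition_holds`
and is recorded only to close the conditional bookkeeping of the lineages that typed it.
-/

noncomputable section

namespace Summit.KontsevichZagierPeriods.Zeta5Search.DecompositionConsequences

open Summit.KontsevichZagierPeriods.Zeta5Search.DecompositionWholeCone (decomposition_holds)
open Summit.KontsevichZagierPeriods.Zeta5Search.WedgeDictionaryClosing (wedgeDictionary_holds)
open Summit.KontsevichZagierPeriods.Zeta5Search.InvarianceOfConverges (invariance_of_converges'_holds)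
open Summit.KontsevichZagierPeriods.Zeta5Search.Families.Cellular
open Summit.KontsevichZagierPeriods.Zeta5Search.WedgeDictionary (wedgeDictionaryIntegralPart wedgeDictionary_iff_integralPart)
open Literature.NumberTheory.Irrationality.BrownZudilin2022
open Literature.NumberTheory.Transcendental (zetaValue)

/-! ## 1. The three obligation nodes -/

/-- **The `@[conjecture]` node `BZSubconeZeta3Free` holds**: on the weight-certified `A_basic`-sub-cone every convergent
cellular integral lies in `ℚθ + ℚζ(2) + ℚ` (fam-brown8; by `bzSubconeZeta3Free_of_decomposition`). [folklore] -/
theorem bzSubconeZeta3Free_holds : BZSubconeZeta3Free := bzSubconeZeta3Free_of_decomposition decomposition_holds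

/-- **The `@[conjecture]` node `BZXStarZeta3Free` holds**: on the `X*`-region every convergent cellular integral lies in
`ℚθ + ℚζ(2) + ℚ` (fam-brown8; by `bzXStarZeta3Free_of_decomposition`). [folklore] -/
theorem bzXStarZeta3Free_holds : BZXStarZeta3Free := bzXStarZeta3Free_of_decomposition decomposition_holds

/-- **The `@[conjecture]` node `wedgeDictionaryIntegralPart` holds** (the cellular-integral half of gen-1's wedge dictionary,
`WedgeDictionaryQPart`; by `wedgeDictionary_iff_integralPart` and ct-1 g21's `wedgeDictionary_holds`). [folklore] -/
theorem wedgeDictionaryIntegralPart_holds : wedgeDictionaryIntegralPart :=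
  wedgeDictionary_iff_integralPart.1 wedgeDictionary_holds

/-! ## 2. Off the live cone: `ℚζ(2) + ℚ` (fam-brown8 g11's corollaries, now unconditional) -/

/-- **Off the live cone the cellular integral lies in `ℚζ(2) + ℚ`**: for convergent, non-live `a`, `I(a) = rζ(2) + s` with
`r, s ∈ ℚ` (`mem_QZeta2_of_not_liveBZ` fed with `decomposition_holds`; `¬ LiveBZ a ↔ Q(a) = 0` by `liveBZ_iff_QOf_ne_zero`).
[folklore] -/
theorem mem_QZeta2_of_not_liveBZ (a : Fin 8 → ℤ) (hc : Converges a) (hl : ¬ LiveBZ a) :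
    ∃ r s : ℚ, cellularIntegral a = r * zetaValue 2 + s :=
  Families.Cellular.mem_QZeta2_of_not_liveBZ decomposition_holds a hc hl

/-- The same, phrased with the printed leading coefficient: a convergent `a` with `Q(a) = 0` has `I(a) ∈ ℚζ(2) + ℚ`. [folklore] -/
theorem mem_QZeta2_of_QOf_eq_zero (a : Fin 8 → ℤ) (hc : Converges a) (hQ : QOf a = 0) :
    ∃ r s : ℚ, cellularIntegral a = r * zetaValue 2 + s :=
  mem_QZeta2_of_not_liveBZ a hc fun hl => (liveBZ_iff_QOf_ne_zero a hc).1 hl hQ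

/-- **Off the live cone the whole ray carries no `ζ(5)` and no `ζ(3)`**: `I(n·a) = rζ(2) + s` for every `n ≥ 1`
(`ray_mem_QZeta2_of_not_liveBZ` fed with `decomposition_holds`). [folklore] -/
theorem ray_mem_QZeta2_of_not_liveBZ (a : Fin 8 → ℤ) (hc : Converges a) (hl : ¬ LiveBZ a) {n : ℤ} (hn : 1 ≤ n) :
    ∃ r s : ℚ, cellularIntegral (fun i => n * a i) = r * zetaValue 2 + s :=
  Families.Cellular.ray_mem_QZeta2_of_not_liveBZ decomposition_holds a hc hl hn

/-- The specimen `c = (2,0,4,0,2,1,1,4)` (convergent, not live, outside the `X*`-region): `I(c) ∈ ℚζ(2) + ℚ`. [folklore] -/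
theorem specimenC_mem_QZeta2 : ∃ r s : ℚ, cellularIntegral specimenC = r * zetaValue 2 + s :=
  specimenC_mem_QZeta2_of decomposition_holds

/-! ## 3. The whole cone -/

/-- **The whole convergent cone, trichotomy form**: `I(a) = qθ + rζ(2) + s` with rational `q, r, s`, and `q ≠ 0 ↔ LiveBZ a`
(`decomposition_live_iff` fed with `decomposition_holds`; `q = Q(a)`). [folklore] -/
theorem decomposition_live_iff (a : Fin 8 → ℤ) (hc : Converges a) :
    ∃ q r s : ℚ, cellularIntegral a = q * (2 * zetaValue 5 + 4 * zetaValue 3 * zetaValue 2) + r * zetaValue 2 + s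
      ∧ (q ≠ 0 ↔ LiveBZ a) :=
  Families.Cellular.decomposition_live_iff decomposition_holds a hc

/-- **The census/mw capstone, unconditional**: on the live cone `I(a) ∈ ℚθ + ℚζ(2) + ℚ` BY THE SYMMETRY-COVER ROUTE
(`liveBZ_zeta3Free_of`: the `X*`-law transported along a convergent chain by (27)), its two hypotheses being the theorems
`invariance_of_converges'_holds` (ct-1 g13) and `bzXStarZeta3Free_holds`.  (As a statement this is weaker than
`decomposition_holds`; the content recorded is that the fam-brown8 route closes.) [folklore] -/
theorem liveBZ_zeta3Free (a : Fin 8 → ℤ) (hc : Converges a) (hl : LiveBZ a) :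
    ∃ q r s : ℚ, cellularIntegral a = q * (2 * zetaValue 5 + 4 * zetaValue 3 * zetaValue 2) + r * zetaValue 2 + s :=
  liveBZ_zeta3Free_of invariance_of_converges'_holds bzXStarZeta3Free_holds a hc hl

end Summit.KontsevichZagierPeriods.Zeta5Search.DecompositionConsequences
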